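import Literature.Computability.AlgebraicComplexity.Kron444HullCheck
import HarnessLib

/-!
# `Kron(4,4,4) ⊆ conv(328 vertices)`: certificate checks, part 3/14

Proofs file (computations only): the node checks of `Kron444HullCheck.lean` for the chunks
25 … 37 of the certificate, each decided by the kernel (`decide +kernel`; `maxHeartbeats 0`:
a chunk is ≈ 10⁵–10⁶ kernel reductions). Assembled in `Kron444Hull.lean`. [folklore]
-/

set_option Elab.async false

namespace Literature.Computability.AlgebraicComplexity.Kron444Hull

/-- Nodes `625 … 649` of the certificate (chunk `25`) pass `checkNodeRec`. [folklore] -/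
theorem checkChunk_25 : checkChunk 25 25 = true := by
  set_option maxHeartbeats 0 in decide +kernel

/-- Nodes `650 … 674` of the certificate (chunk `26`) pass `checkNodeRec`. [folklore] -/
theorem checkChunk_26 : checkChunk 26 25 = true := by
  set_option maxHeartbeats 0 in decide +kernel

/-- Nodes `675 … 699` of the certificate (chunk `27`) pass `checkNodeRec`. [folklore] -/
theorem checkChunk_27 : checkChunk 27 25 = true := by
  set_option maxHeartbeats 0 in decide +kernel

/-- Nodes `700 … 724` of the certificate (chunk `28`) pass `checkNodeRec`. [folklore] -/
theorem checkChunk_28 : checkChunk 28 25 = true := by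
  set_option maxHeartbeats 0 in decide +kernel

/-- Nodes `725 … 749` of the certificate (chunk `29`) pass `checkNodeRec`. [folklore] -/
theorem checkChunk_29 : checkChunk 29 25 = true := by
  set_option maxHeartbeats 0 in decide +kernel

/-- Nodes `750 … 774` of the certificate (chunk `30`) pass `checkNodeRec`. [folklore] -/
theorem checkChunk_30 : checkChunk 30 25 = true := by
  set_option maxHeartbeats 0 in decide +kernel

/-- Nodes `775 … 799` of the certificate (chunk `31`) pass `checkNodeRec`. [folklore] -/
theorem checkChunk_31 : checkChunk 31 25 = true := by
  set_option maxHeartbeats 0 in decide +kernel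

/-- Nodes `800 … 824` of the certificate (chunk `32`) pass `checkNodeRec`. [folklore] -/
theorem checkChunk_32 : checkChunk 32 25 = true := by
  set_option maxHeartbeats 0 in decide +kernel

/-- Nodes `825 … 849` of the certificate (chunk `33`) pass `checkNodeRec`. [folklore] -/
theorem checkChunk_33 : checkChunk 33 25 = true := by
  set_option maxHeartbeats 0 in decide +kernel

/-- Nodes `850 … 874` of the certificate (chunk `34`) pass `checkNodeRec`. [folklore] -/
theorem checkChunk_34 : checkChunk 34 25 = true := by
  set_option maxHeartbeats 0 in decide +kernel

/-- Nodes `875 … 899` of the certificate (chunk `35`) pass `checkNodeRec`. [folklore] -/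
theorem checkChunk_35 : checkChunk 35 25 = true := by
  set_option maxHeartbeats 0 in decide +kernel

/-- Nodes `900 … 924` of the certificate (chunk `36`) pass `checkNodeRec`. [folklore] -/
theorem checkChunk_36 : checkChunk 36 25 = true := by
  set_option maxHeartbeats 0 in decide +kernel

/-- Nodes `925 … 949` of the certificate (chunk `37`) pass `checkNodeRec`. [folklore] -/
theorem checkChunk_37 : checkChunk 37 25 = true := by
  set_option maxHeartbeats 0 in decide +kernel

end Literature.Computability.AlgebraicComplexity.Kron444Hull
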